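import Literature.Analysis.FluidPDE.CKNMorreyKukavica
import Literature.Analysis.FluidPDE.CKNMorreyPressureEstimates
import Literature.Analysis.FluidPDE.CKNMorreyBootstrapDual
import Literature.Analysis.FluidPDE.MultiplierHeatKernelDecay
import Literature.Analysis.FluidPDE.CKNInterpolationEstimate
import HarnessLib

/-!
# Caffarelli–Kohn–Nirenberg 1982, Proposition 2: the proof by the parabolic-Morrey route

Analysis/FluidPDE proofs file for the named fact `Literature.Analysis.FluidPDE.CKN1982.proposition2`
(`CKN1982Setting.lean`: Caffarelli–Kohn–Nirenberg 1982, Proposition 2 — an *absolute* constant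
`ε₃ > 0` such that a suitable weak solution in the sense of their §2, (2.1)–(2.5)
(`CKN1982.IsSuitableOn D q f u p G`: `f ∈ L^q(D)` for some `q > 5/2`, `div f = 0`,
`p ∈ L^{5/4}(D)`, `u ∈ L^∞_t L²_x ∩ L²_t H¹_x(D)`, (1.1) in `𝒟'(D)`, generalized energy inequality)
with `limsup_{r → 0} r⁻¹ ∫∫_{Q*_r(z)} |∇u|² ≤ ε₃` at `z ∈ D` is essentially bounded near `z`).

We **prove** Proposition 2 from the three printed lemmas of Lemarié-Rieusset's parabolic-Morrey
proof of the criterion (2016, §13.9, after Kukavica), all of which are declared in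
`CKNMorreyLemmas.lean` and two of which the tree has already discharged:

* `CKN1982.proposition2_of_lemmas : lemma13_4 → lemma13_5 → lemma13_6 → proposition2`;
* `CKN1982.proposition2_of_lemma13_6 : lemma13_6 → proposition2`, feeding in the tree's
  `lemma13_4_of lemma13_3_holds interpolationEstimate_holds` and `lemma13_5_holds`;
* `CKN1982.proposition2_of_duhamel : lemma13_6_duhamel → proposition2`, through the tree's
  `lemma13_6_of_duhamel_holds` (Prop. 13.4 being proved, `prop13_4_holds`).

So the trust base of Proposition 2 is reduced to the single named fact
`LemarieRieusset2016.lemma13_6_duhamel` (`CKNMorreyHolder.lean`: the localised Duhamel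
representation (13.50)–(13.52)); `proposition2_holds` is
`proposition2_of_duhamel lemma13_6_duhamel_holds` as soon as that fact is discharged.

## Why the constant is absolute

Lemarié-Rieusset's Thm. 13.8 prints "`ε*` depends only on `ν` and `τ₀`" (`τ₀ > 5/2` the Morrey
exponent of the force), which is why the accepted `CKNEpsilonRegularity.lean` could only derive the
exponent-dependent form `∀ q > 5/2, ∃ ε(q)` of the criterion. But smallness is used in exactly one
place of the printed proof, Lemma 13.4 (p. 470), and that lemma is stated — and vendored, and proved
in the tree (`lemma13_4_of`) — for a force `1_Ω f ∈ ℳ₂^{10/7,τ₀}` with **`τ₀ > 5/3`** only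
("Assumption `1_{Q₀} f ∈ ℳ₂^{10/7,5/3+ε}` is borrowed from Kukavica", Remark p. 470; `5/3` is the
scale-critical space–time exponent of the force), under the side conditions
`1 < τ₂/5 < min(q₀, 2)`, `2 - 5/τ₀ + 5/τ₂ > 0`. Every Caffarelli–Kohn–Nirenberg force
`f ∈ L^q(D)`, `q > 5/2`, restricted to a bounded centred cylinder `Ω = Q*_{r₁}(z)`, lies in the one
class `ℳ₂^{10/7,5/2}` (Hölder on `Q*_r ∩ Ω`: `L^q(Ω) ⊆ ℳ₂^{10/7,q}`, and
`ℳ₂^{10/7,q} ⊆ ℳ₂^{10/7,5/2}` on the bounded `Ω`, `IsParabolicMorreyOn.of_exponent_le`), and CKN's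
pressure class `L^{5/4}(D)` is Lemarié-Rieusset's `p ∈ L^{q₀}_{t,x}(Ω)` with `q₀ = 5/4`. Hence
Lemma 13.4 is applied with the *fixed* exponents `(ν, q₀, τ₀, τ₂) = (1, 5/4, 5/2, 6)`
(`1 < 6/5 < 5/4`, `2 - 2 + 5/6 > 0`), and its `ε* = ε*(1, 5/4, 5/2, 6)` is an absolute constant;
`ε₃ = ε*/2` turns CKN's `≤ ε₃` into the printed `< ε*`. The remaining two lemmas, 13.5 (further
Morrey estimates) and 13.6 (Hölder continuity), carry no smallness hypothesis, so they are
applied with the Morrey exponent `τ₀ := q > 5/2` of the given force (`1_{Q₂} f ∈ ℳ₂^{10/7,q}`),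
exactly as in the accepted assembly
`lemarieRieusset_ckn_criterion_qdep_of_lemmas` (`r₃ = r₂/2`, then `r₂/4`); a parabolic-Hölder
representative on `Q*_{r₂/4}(z)` makes `z` a regular point
(`isRegularPoint_of_holder_representative`). This recovers Caffarelli–Kohn–Nirenberg's own
quantifier order `∃ ε₃ ∀ q` (their Proposition 2: "There is an absolute constant `ε₃ > 0` …",
the exponent `q` living in the standing hypothesis (2.1) of §2).

## What is NOT here

No new definition and no new named fact (D-0026). Caffarelli–Kohn–Nirenberg's own route
(Proposition 1 with the `L^{5/4}`-pressure smallness `∫ (∫ |p|)^{5/4}`, the decay Proposition 3,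
§§3–6 of the paper) is not formalised; the paper itself is not held by the literature store (the
statement proved is the accepted vendored `CKN1982.proposition2`, whose hypotheses are the list
1–6 of Lemarié-Rieusset 2016, p. 459).

## References

* L. Caffarelli, R. Kohn, L. Nirenberg, *Partial regularity of suitable weak solutions of the
  Navier–Stokes equations*, Comm. Pure Appl. Math. 35 (1982), 771–831: §2 (2.1)–(2.6),
  Proposition 2. [CaffarelliKohnNirenberg1982]
* P. G. Lemarié-Rieusset, *The Navier–Stokes Problem in the 21st Century*, CRC Press (2016):
  §13.8 p. 459 (CKN's hypotheses 1–7), Def. 13.4 p. 460, Thm. 13.8 pp. 462–463; §13.9,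
  Lemma 13.4 and Remark p. 470, Lemma 13.5 p. 475, Lemma 13.6 p. 477, Step 4 p. 477.
  [LemarieRieusset2016]
* I. Kukavica, *On partial regularity for the Navier–Stokes equations*, Discrete Contin. Dyn.
  Syst. 21 (2008), 717–728 (the Morrey-space argument with force exponent `> 5/3`). [Kukavica2008]
-/

noncomputable section

open MeasureTheory Set Function Filter Topology TopologicalSpace Metric
open scoped NNReal ENNReal InnerProductSpace RealInnerProductSpace Laplacian

namespace Literature.Analysis.FluidPDE

namespace CKN1982

/-- **The Morrey class of a Caffarelli–Kohn–Nirenberg force**: if `f ∈ L^q(Ω)` with `q > 10/7`,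
then `1_Ω f ∈ ℳ₂^{10/7,q}` (Hölder on `Q*_r(z) ∩ Ω`, whose volume is `≤ 2|B₁| r⁵`;
Lemarié-Rieusset 2016, p. 462: the Morrey norm may be computed on the cylinders). [folklore] -/
theorem isParabolicMorreyOn_force_of_memLp {Ω : Set (ℝ × EuclideanSpace ℝ (Fin 3))}
    {f : ℝ → EuclideanSpace ℝ (Fin 3) → EuclideanSpace ℝ (Fin 3)} {q : ℝ} (hq : 10 / 7 < q)
    (hf : MemLp (uncurry f) (ENNReal.ofReal q) (volume.restrict Ω)) :
    IsParabolicMorreyOn Ω (fun w => ‖f w.1 w.2‖ₑ) (10 / 7) q := by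
  have hq0 : 0 < q := lt_trans (by norm_num) hq
  refine isParabolicMorreyOn_force_of ?_
  set A : ℝ≥0∞ := ∫⁻ w in Ω, ‖f w.1 w.2‖ₑ ^ q with hA
  have hAfin : A < ∞ := by
    have := hf.2
    rw [eLpNorm_lt_top_iff_lintegral_rpow_enorm_lt_top (by simp [hq0]) ENNReal.ofReal_ne_top,
      ENNReal.toReal_ofReal hq0.le] at this
    exact this
  set M₀ : ℝ≥0∞ := A ^ (10 / (7 * q)) *
    (2 * volume (ball (0 : EuclideanSpace ℝ (Fin 3)) 1)) ^ (1 - 10 / (7 * q)) with hM₀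
  have hθ : 0 ≤ 1 - 10 / (7 * q) := by
    rw [sub_nonneg, div_le_one (by positivity)]
    linarith
  have hM₀fin : M₀ ≠ ∞ :=
    ENNReal.mul_ne_top (ENNReal.rpow_ne_top_of_nonneg (by positivity) hAfin.ne)
      (ENNReal.rpow_ne_top_of_nonneg hθ (ENNReal.mul_ne_top (by simp) measure_ball_lt_top.ne))
  refine ⟨M₀.toNNReal, fun z r hr => ?_⟩
  rw [ENNReal.coe_toNNReal hM₀fin]
  exact setLIntegral_cylinder_inter_le_of_lintegral_le hq hf.1 le_rfl z hr

/-- **Caffarelli–Kohn–Nirenberg 1982, Proposition 2, from Lemmas 13.4, 13.5, 13.6 of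
Lemarié-Rieusset 2016** (§13.9, after Kukavica 2008), with an *absolute* constant: Lemma 13.4 is
applied on a centred cylinder `Ω = Q*_{r₁}(z) ⊆ D` with the fixed exponents
`(ν, q₀, τ₀, τ₂) = (1, 5/4, 5/2, 6)` — legitimate because Lemma 13.4 only asks `τ₀ > 5/3` (Remark
p. 470) and every force `f ∈ L^q(Ω)`, `q > 5/2`, lies in `ℳ₂^{10/7,5/2}` on the bounded `Ω`, while
`p ∈ L^{5/4}(D)` is the pressure class `q₀ = 5/4` — so that its smallness constant `ε*` does not
depend on `q`; `ε₃ = ε*/2`. Lemmas 13.5 and 13.6 (no smallness) are then applied with the Morrey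
exponent `τ₀ := q` of the force, on `Q*_{r₂}(z)`, `Q*_{r₂/2}(z)`, `Q*_{r₂/4}(z)` (Step 4, p. 477),
and the parabolic-Hölder representative on `Q*_{r₂/4}(z)` is essentially bounded there, i.e. `z`
is a regular point (`IsRegularPoint`: CKN's definition, §6; Lemarié-Rieusset's Def. 13.1 and
item 7 p. 459). [cite: LemarieRieusset2016, Lemma 13.4 and Remark p. 470; Lemmas 13.5–13.6 pp. 475–477; §13.9 Step 4 p. 477] -/
theorem proposition2_of_lemmas (h4 : LemarieRieusset2016.lemma13_4)
    (h5 : LemarieRieusset2016.lemma13_5) (h6 : LemarieRieusset2016.lemma13_6) :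
    proposition2 := by
  -- Lemma 13.4 with the fixed exponents `(ν, q₀, τ₀, τ₂) = (1, 5/4, 5/2, 6)`: an absolute `ε`
  obtain ⟨ε, hε, H4⟩ := h4 1 (5 / 4) (5 / 2) 6 one_pos (by norm_num) (by norm_num) (by norm_num)
    (by norm_num) (by norm_num) (by norm_num)
  refine ⟨ε / 2, by positivity, ?_⟩
  intro D q f u p G hS z hz hlim
  have hq : 5 / 2 < q := hS.exponent
  -- a closed parabolic box around `z` inside `D`, and the open centred cylinder `Ω` inside it
  obtain ⟨r₁, hr₁, -, hKD⟩ := exists_closedCylinder_subset D.isOpen hz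
  set K : Set (ℝ × EuclideanSpace ℝ (Fin 3)) :=
    Icc (z.1 - r₁ ^ 2) (z.1 + r₁ ^ 2) ×ˢ closedBall z.2 r₁ with hK
  have hKc : IsCompact K := isCompact_Icc.prod (isCompact_closedBall _ _)
  set Ω : Opens (ℝ × EuclideanSpace ℝ (Fin 3)) := parabolicCylinderCenteredOpens r₁ z with hΩdef
  have hΩ : (Ω : Set (ℝ × EuclideanSpace ℝ (Fin 3))) = parabolicCylinderCentered r₁ z := rfl
  have hΩK : (Ω : Set (ℝ × EuclideanSpace ℝ (Fin 3))) ⊆ K :=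
    parabolicCylinderCentered_subset_closedCylinder r₁ z
  have hΩD' : (Ω : Set (ℝ × EuclideanSpace ℝ (Fin 3))) ⊆ (D : Set _) := hΩK.trans hKD
  have hΩD : Ω ≤ D := hΩD'
  have hzΩ : z ∈ Ω := self_mem_parabolicCylinderCentered hr₁ z
  have hΩfin : volume (Ω : Set (ℝ × EuclideanSpace ℝ (Fin 3))) < ∞ :=
    (measure_mono hΩK).trans_lt hKc.measure_lt_top
  haveI : IsFiniteMeasure (volume.restrict (Ω : Set (ℝ × EuclideanSpace ℝ (Fin 3)))) :=
    ⟨by rw [Measure.restrict_apply_univ]; exact hΩfin⟩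
  -- the force on `Ω`: `L^q(Ω) ⊆ L^{10/7}(Ω)`, `1_Ω f ∈ ℳ₂^{10/7,q} ⊆ ℳ₂^{10/7,5/2}`
  have hfΩq : MemLp (uncurry f) (ENNReal.ofReal q) (volume.restrict (Ω : Set _)) :=
    hS.force_memLp.mono_measure (Measure.restrict_mono hΩD' le_rfl)
  have hfΩ : MemLp (uncurry f) (ENNReal.ofReal (10 / 7)) (volume.restrict (Ω : Set _)) :=
    hfΩq.mono_exponent (ENNReal.ofReal_le_ofReal (by linarith))
  have hMq : IsParabolicMorreyOn (Ω : Set _) (fun w => ‖f w.1 w.2‖ₑ) (10 / 7) q :=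
    isParabolicMorreyOn_force_of_memLp (lt_trans (by norm_num) hq) hfΩq
  have hM52 : IsParabolicMorreyOn (Ω : Set _) (fun w => ‖f w.1 w.2‖ₑ) (10 / 7) (5 / 2) :=
    hMq.of_exponent_le (Eq.subset hΩ) hr₁ (by norm_num) (by norm_num) hq.le (by norm_num)
  -- the standing hypotheses of §13.9 on `Ω`, viscosity `1`, pressure exponent `q₀ = 5/4`
  have hS' : LemarieRieusset2016.IsSuitableOn Ω 1 (5 / 4) f u p G :=
    { isConnected := isConnected_parabolicCylinderCentered hr₁ z
      energy := by
        obtain ⟨E₀, hE₀⟩ := hS.energy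
        refine ⟨E₀, ?_⟩
        filter_upwards [hE₀] with t ht
        refine (lintegral_mono fun x => ?_).trans ht
        exact indicator_le_indicator_of_subset hΩD' (fun _ => zero_le) _
      hasWeakSpatialGradientOn := hS.weakGrad.mono hΩD
      gradient_sq_lt_top := (lintegral_mono_set hΩD').trans_lt hS.dissipation
      pressure_lt_top := (lintegral_mono_set hΩD').trans_lt hS.pressure
      force_memLp := hfΩ
      divFree_force := fun φ hφ => hS.force_div φ (hφ.mono hΩD)
      solution := hS.distributional.of_le hΩD
      localEnergy := fun φ hφ hφ0 => by
        have := hS.localEnergy φ (hφ.mono hΩD) hφ0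
        simpa only [one_mul, mul_one] using this }
  -- the `limsup` hypothesis of Proposition 2 is that of Lemma 13.4, strictly below `ε`
  unfold deltaStar at hlim
  have hlim' : limsup (fun r : ℝ => (ENNReal.ofReal r)⁻¹ *
      ∫⁻ w in parabolicCylinderCentered r z,
        ENNReal.ofReal (frobeniusNormSq (G w.1 w.2))) (𝓝[>] (0 : ℝ)) < ENNReal.ofReal ε :=
    hlim.trans_lt ((ENNReal.ofReal_lt_ofReal_iff hε).2 (by linarith))
  -- Lemma 13.4 on `Ω`
  obtain ⟨r₂, hr₂, hQ₂Ω, hMu, -, hMG⟩ := H4 Ω f u p G hS' hM52 z hzΩ hlim'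
  -- the force on `Q*_{r₂}(z)`: `ℳ₂^{10/7,q}` with `q > 5/2`
  have hMf₂ : IsParabolicMorreyOn (parabolicCylinderCentered r₂ z) (fun w => ‖f w.1 w.2‖ₑ)
      (10 / 7) q := hMq.mono hQ₂Ω
  -- Lemma 13.5 with `r₃ = r₂/2`
  obtain ⟨σ, hσ, hσineq, hMuσ⟩ := h5 1 (5 / 4) q 6 Ω f u p G z r₂ one_pos (by norm_num)
    (by norm_num) hq (by norm_num) hr₂ hS' hQ₂Ω hMf₂ hMu hMG (r₂ / 2) (by positivity) (by linarith)
  have hQ₃Q₂ : parabolicCylinderCentered (r₂ / 2) z ⊆ parabolicCylinderCentered r₂ z :=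
    parabolicCylinderCentered_mono (by positivity) (by linarith) z
  -- Lemma 13.6 on `Q*_{r₂/2}(z)` with `r₃ = r₂/4`
  obtain ⟨w, C, α, hα0, -, hw, hae⟩ := h6 1 (5 / 4) q 6 σ Ω f u p G z (r₂ / 2) one_pos
    (by norm_num) (by norm_num) hq (by norm_num) hσ hσineq (by positivity) hS' (hQ₃Q₂.trans hQ₂Ω)
    (hMf₂.mono hQ₃Q₂) (hMu.mono hQ₃Q₂) hMuσ (hMG.mono hQ₃Q₂) (r₂ / 4) (by positivity)
    (by linarith)
  -- a parabolic-Hölder representative near `z` is essentially bounded there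
  exact isRegularPoint_of_holder_representative (ρ := r₂ / 4) (by positivity) hα0.le hw hae

/-- **Caffarelli–Kohn–Nirenberg 1982, Proposition 2, conditional on Lemma 13.6 of
Lemarié-Rieusset 2016 only**: Lemma 13.4 is the tree's `lemma13_4_of lemma13_3_holds
interpolationEstimate_holds` and Lemma 13.5 is `lemma13_5_holds`. [cite: LemarieRieusset2016, §13.9 Lemmas 13.3–13.5 pp. 470–477] -/
theorem proposition2_of_lemma13_6 (h6 : LemarieRieusset2016.lemma13_6) : proposition2 :=
  proposition2_of_lemmas
    (LemarieRieusset2016.lemma13_4_of LemarieRieusset2016.lemma13_3_holds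
      interpolationEstimate_holds)
    LemarieRieusset2016.lemma13_5_holds h6

/-- **Caffarelli–Kohn–Nirenberg 1982, Proposition 2, conditional on the localised Duhamel
representation (13.50)–(13.52) only** (`LemarieRieusset2016.lemma13_6_duhamel`, the last
undischarged input: Lemma 13.6 follows from it and the proved Prop. 13.4,
`lemma13_6_of_duhamel_holds`). The discharge `proposition2_holds` is
`proposition2_of_duhamel lemma13_6_duhamel_holds` once that fact is proved. [cite: LemarieRieusset2016, §13.9 Step 3 (13.50)–(13.52) pp. 474–475; Lemma 13.6 p. 477] -/
theorem proposition2_of_duhamel (hD : LemarieRieusset2016.lemma13_6_duhamel) : proposition2 :=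
  proposition2_of_lemma13_6 (LemarieRieusset2016.lemma13_6_of_duhamel_holds hD)

end CKN1982

end Literature.Analysis.FluidPDE
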